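import Summits.CriticalPhenomena.SAWScalingLimit.Theses.SAWLoopFugacityFlow
import Literature.Probability.RandomPlanarGeometry.LoewnerDescription
import Literature.Probability.RandomPlanarGeometry.CurveSpace

/-!
Sketch for crux-ideate stmt-CriticalPhenomena-4982 (SimpleSubseqLimits), ideator 2, round 1.
First lemmas of the two idea cards, stated as `Prop`s over existing declarations (not proved).
-/

namespace Summit.CriticalPhenomena.SAWScalingLimit.Cruxes.SimpleSubseqLimits.Ideator2

open Literature.Probability.RandomPlanarGeometry MeasureTheory Filter Set
open scoped unitInterval

/-- Card `arc-range-loewner-clock`, FIRST LEMMA (deterministic "arc clock"): a Loewner-describable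
curve class whose RANGE is the range of a simple chord of `(D; a, b)` meeting `∂D` only at `a, b`
is itself simple (and runs from `a` to `b`). Content: the generating curve `γ` of the chain has
`fill γ[0,t] = K_t` strictly increasing (`hcap K_t = 2t`); inside an arc attached to `ℝ` at `0`
only, `γ[0,t]` is an initial sub-arc and its fill is itself, so the sub-arcs strictly increase and
`γ(t)` is always the new endpoint, i.e. `γ` is injective. -/
def ArcClock : Prop :=
  ∀ (D : DobrushinDomain) (φ : ConformalEquiv UpperHalfPlane.upperHalfPlaneSet D.carrier),
    D.IsChordalUniformizing φ → ∀ (c c' : CurveClass ℂ),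
      IsLoewnerDescribable φ c → c' ∈ CurveClass.simple → c'.source = D.pt 0 →
      c'.target = D.pt 1 → c'.range ⊆ closure D.carrier →
      c'.range ∩ frontier D.carrier ⊆ {D.pt 0, D.pt 1} → c.range = c'.range →
      c ∈ CurveClass.simple ∧ c.source = D.pt 0 ∧ c.target = D.pt 1

/-- Card `marked-point-revisit`, FIRST LEMMA (deterministic "shadowing"): if a curve `γ` has the
same range and endpoints as an injective curve `η` but its class is not simple, then there is a
time `s` at which `γ` sits at a NEW extreme point `η y₁` of the arc (never visited before `s`) and a
whole non-degenerate sub-arc `η [y₀, y₁)` every point of which was visited before `s` AND is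
revisited after `s` (before some time `t`). This is what turns "no retracing" into a ONE-POINT
no-revisit estimate at a past-measurable marked point. -/
def Shadowing : Prop :=
  ∀ (η γ : Curve ℂ), η.IsSimple → Set.range γ = Set.range η → γ 0 = η 0 → γ 1 = η 1 →
    CurveClass.mk γ ∉ CurveClass.simple →
    ∃ (s t : I) (y₀ y₁ : I), s < t ∧ y₀ < y₁ ∧ γ s = η y₁ ∧ (∀ r, r < s → γ r ≠ η y₁) ∧
      (∀ r, r ≤ t → ∃ y, y ≤ y₁ ∧ γ r = η y) ∧
      ∀ y : I, y₀ ≤ y → y < y₁ →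
        (∃ r, r < s ∧ γ r = η y) ∧ (∃ r', s < r' ∧ r' ≤ t ∧ γ r' = η y)

/-- Shape of the common A-side input of both cards ("range is an arc"): for a subsequential weak
limit `ν` of the critical SAW laws (hypotheses of the crux verbatim), `ν`-a.e. class has the range
of a simple chord of `(D; a, b)` meeting `∂D` only at `a, b`. (To be derived from AvoidanceLimit +
AvoidancePassage + SLEAvoidanceValue + SLECarrier + a range version of LSW03 Lemma 3.2 using the
tree's `chordalFill`.) -/
def RangeIsArc : Prop :=
  ∀ (D : DobrushinDomain) (a b : ℝ → Literature.Probability.LatticeModels.Site 2),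
    SAW.IsEndpointApprox D a b → ∀ (s : ℕ → ℝ) (ν : Measure (CurveClass ℂ)),
      Tendsto s atTop (nhdsWithin 0 (Set.Ioi 0)) → IsProbabilityMeasure ν →
      (∀ f : BoundedContinuousFunction (CurveClass ℂ) ℝ,
        Tendsto (fun n => ∫ γ, f γ.curve ∂(SAW.law D.carrier (s n) (a (s n)) (b (s n)))) atTop
          (nhds (∫ x, f x ∂ν))) →
      ∀ᵐ c ∂ν, ∃ c' ∈ CurveClass.simple, c'.source = D.pt 0 ∧ c'.target = D.pt 1 ∧
        c'.range ⊆ closure D.carrier ∧ c'.range ∩ frontier D.carrier ⊆ {D.pt 0, D.pt 1} ∧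
        c'.range = c.range

/-- Shape of card 1's path-level input (Kemppainen–Smirnov describability of the limit, fed by a
G-condition crux such as `SAWParafermion.KSAdmissibleG1` through the tree theorem
`ae_isLoewnerDescribable_and_tendstoInDistribution_of_regularCurves`). -/
def DescribableLimit : Prop :=
  ∀ (D : DobrushinDomain) (a b : ℝ → Literature.Probability.LatticeModels.Site 2),
    SAW.IsEndpointApprox D a b → ∀ (s : ℕ → ℝ) (ν : Measure (CurveClass ℂ)),
      Tendsto s atTop (nhdsWithin 0 (Set.Ioi 0)) → IsProbabilityMeasure ν →
      (∀ f : BoundedContinuousFunction (CurveClass ℂ) ℝ,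
        Tendsto (fun n => ∫ γ, f γ.curve ∂(SAW.law D.carrier (s n) (a (s n)) (b (s n)))) atTop
          (nhds (∫ x, f x ∂ν))) →
      ∀ (φ : ConformalEquiv UpperHalfPlane.upperHalfPlaneSet D.carrier), D.IsChordalUniformizing φ →
        ∀ᵐ c ∂ν, IsLoewnerDescribable φ c

/-- Card 1 composition (kernel-checkable once the three inputs are theorems): the crux follows. -/
theorem simpleSubseqLimits_of_arcClock (hAC : ArcClock) (hR : RangeIsArc) (hDL : DescribableLimit) :
    Summit.CriticalPhenomena.SAWScalingLimit.Theses.SAWLoopFugacityFlow.SimpleSubseqLimits := by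
  intro D a b hab s ν hs hν hlim
  obtain ⟨φ, hφ⟩ := MarkedDomain.exists_isChordalUniformizing_holds D
  have h1 := hR D a b hab s ν hs hν hlim
  have h2 := hDL D a b hab s ν hs hν hlim φ hφ
  filter_upwards [h1, h2] with c hc hd
  obtain ⟨c', hc's, h0, h1', hcl, hfr, hrange⟩ := hc
  obtain ⟨hsimple, hs0, ht1⟩ := hAC D φ hφ c c' hd hc's h0 h1' hcl hfr hrange.symm
  exact ⟨hsimple, hs0, ht1, hrange ▸ hcl, hrange ▸ hfr⟩

/-- Card `marked-point-revisit`, limit-level path input ("no revisit of a marked point"): for a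
subsequential weak limit `ν` (hypotheses of the crux verbatim), `ν`-a.e. class has a representative
`γ` such that for all rational centres `q` and radii `ρ > 0`: whenever `γ` enters `closedBall q ρ`
at a time `σ` after having last entered `closedBall q (4ρ)` at the time `λ < σ` (so the MARKED
POINT `γ λ` lies on `sphere q (4ρ)` and is a measurable function of the past up to the stopping
time `σ`), the future after `σ` never returns to the marked point `γ λ`. On the lattice this is
fed, through the exact domain Markov property of the `x_c`-law at the stopping time `σ`, by the
ONE-POINT estimate OPNT-avg: `lim_{ε→0} limsup_δ E_δ[ P^{SAW}_{Ω_δ ∖ γ[0,σ]}(γ_σ → b_δ)(hit B(γ_λ, ε)) ] = 0`. -/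
def NoMarkedRevisit : Prop :=
  ∀ (D : DobrushinDomain) (a b : ℝ → Literature.Probability.LatticeModels.Site 2),
    SAW.IsEndpointApprox D a b → ∀ (s : ℕ → ℝ) (ν : Measure (CurveClass ℂ)),
      Tendsto s atTop (nhdsWithin 0 (Set.Ioi 0)) → IsProbabilityMeasure ν →
      (∀ f : BoundedContinuousFunction (CurveClass ℂ) ℝ,
        Tendsto (fun n => ∫ γ, f γ.curve ∂(SAW.law D.carrier (s n) (a (s n)) (b (s n)))) atTop
          (nhds (∫ x, f x ∂ν))) →
      ∀ᵐ c ∂ν, ∃ γ : Curve ℂ, CurveClass.mk γ = c ∧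
        ∀ (q : ℚ × ℚ) (ρ : ℚ), 0 < ρ → ∀ (lam sig : I), lam < sig →
          γ lam ∈ Metric.sphere ((q.1 : ℂ) + (q.2 : ℂ) * Complex.I) (4 * ρ) →
          (∀ u : I, lam ≤ u → u ≤ sig → γ u ∈ Metric.closedBall ((q.1 : ℂ) + (q.2 : ℂ) * Complex.I) (4 * ρ)) →
          γ sig ∈ Metric.closedBall ((q.1 : ℂ) + (q.2 : ℂ) * Complex.I) ρ →
          ∀ t' : I, sig < t' → γ t' ≠ γ lam

/-- Card 2 composition SHAPE (the proof is planar bookkeeping over `Shadowing`: pick rational `q`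
within `ρ/4` of the new extreme point `η y₁`, `ρ < min (dist (η y₀) (η y₁)) (dist a (η y₁)) / 8`,
`lam` = last exit of `closedBall q (4ρ)` before `s`, `σ` = first entry of `closedBall q ρ` after
`lam`; the marked point `γ lam = η ζ` has `y₀ < ζ < y₁`, hence is revisited after `s ≥ σ`). -/
def Card2Composition : Prop := Shadowing → RangeIsArc → NoMarkedRevisit →
    Summit.CriticalPhenomena.SAWScalingLimit.Theses.SAWLoopFugacityFlow.SimpleSubseqLimits

end Summit.CriticalPhenomena.SAWScalingLimit.Cruxes.SimpleSubseqLimits.Ideator2
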